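import Mathlib
import Summits.ValiantsHypothesis.ValiantsHypothesis.Theorems.BarrierLeverPartitionMinorsHitByVPHiddenStatesSymSyzygy
import Summits.ValiantsHypothesis.ValiantsHypothesis.Theorems.BarrierLeverPartitionMinorsHitByVPHiddenStatesSymSyzygyCount

/-!
# Route BarrierLever — item `PartitionMinorsHitByVP` (stmt-ValiantsHypothesis-19717), line `hidden_states`:
# THE SYM²-SYZYGY LAW AT EVERY LEVEL q — Veronese syzygies kill second differences on rows of size ≤ 2q+1

Helper file (`--supports stmt-ValiantsHypothesis-19717`; cell valiant-natproofs, rung V4, 𝒟-side door (c), line `hidden_states`; prover seat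
val-np-p3 gen 22; memo HOME/val-np-p3/g22/MEMO-girth-valnp3-g22.md §8–§9). Bookkeeping `def`s only (`term`, `verMat`, `symOfV`, `extendV`).
Closes NO item. Generalises `…HiddenStatesSymSyzygy` (q = 1, rows of size ≤ 3) and `…HiddenStatesSymSyzygyCount` to every `q`.

THE LAW (level q). One table (`tx none` = origin `o`, `tx (some p)` = state `g_p`), states `S`, coordinates `T`. Call a symmetric matrix `β` on
`S × S` a LEVEL-q SYZYGY MATRIX if every column is a syzygy of the degree-≤q VERONESE vectors of the states on `T`:
`Σ_{p∈S} β p p' · ∏_{a∈A} g_p(a) = 0` for every `p' ∈ S` and every nonempty `A ⊆ T` with `|A| ≤ q`. Then for every row `U ⊆ T` with `|U| ≤ 2q+1`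

  `Σ_{p,p'∈S} β p p' · [x^U(o+g_p+g_p') − x^U(o+g_p) − x^U(o+g_p') + x^U(o)] = 0`      (`sum_secondDiff_eq_zero_veronese`).

Proof: expand the three products with `Finset.prod_add`: the second difference is `Σ_{A⊆U} Σ_{∅≠A₁⊊A} o^{U∖A} g_p^{A₁} g_{p'}^{A∖A₁}`, and for
`|A| ≤ 2q+1` one of `A₁`, `A∖A₁` has size `≤ q`, so summing that factor against `β` is a Veronese syzygy (symmetry of `β` for the right factor).
With zero diagonal and `β ≠ 0` the block-additive matrix whose columns contain the complete pair ball on `S` with its origin and whose rows lie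
in `B_{2q+1}(T)` is SINGULAR (`det_eq_zero_of_veronese`, kernel vector `SymSyzygy.relVec` of the q = 1 file). And such a `β` EXISTS FOR EVERY
TABLE once `C(|S| − M + 1, 2) > |S|`, `M = #{A ⊆ T : 1 ≤ |A| ≤ q} = N_q(|T|) − 1` (`exists_veroneseSyzygyMatrix`: rank–nullity for the Veronese
syzygy space, `Module.finBasis`, injectivity of `c ↦ Σ c{i,j} v_i ⊗ v_j` by linear independence used twice, `Sym2.card`) — closed form
`det_eq_zero_of_veronese_count`. For q = 2 (rows of size ≤ 5) the threshold `C(b − N₂(t) + 2, 2) > b` is one syzygy sharper than the pair-law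
threshold `(b − N₂)² > b + N₂ ⟺ C(b − N₂ + 1, 2) > b` behind `PairBall.not_bp2_window`, and the deficiency count `C(b−N_q(t)+2,2) − b` exceeds the
pair-span law's by `b − N_q(t) + 1` (the pair-column span meets the span of the origin and singleton columns). Kit evidence: q = 1 exact in 26
cases (j333612/j333642); q = 2 not computed (smallest instance is a 55 455 × 54 616 rank at t = 24).

WHAT THIS IS NOT: no rank (deficiency-count) statement, only the determinant threshold; nothing on joins; item 19717 OPEN; nothing on crux 14610 or
VP ≠ VNP, which is NOT proved.
-/

set_option linter.dupNamespace false

namespace Summit.ValiantsHypothesis.ValiantsHypothesis.Theorems.BarrierLever.HiddenStates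

open Finset Matrix Module

noncomputable section

namespace SymSyzygy

variable {h K : ℕ}

/-! ## 1. The expansion of the second difference -/

section expansion

variable (tx : Option (Fin K) → Fin h → ℂ) (U : Finset (Fin h))

/-- The term `g_p^{A₁} · g_{p'}^{A ∖ A₁} · o^{U ∖ A}` of the expansion. -/
def term (p p' : Fin K) (A A₁ : Finset (Fin h)) : ℂ :=
  (∏ a ∈ A₁, tx (some p) a) * (∏ a ∈ A \ A₁, tx (some p') a) * ∏ a ∈ U \ A, tx none a

/-- `∏_{a∈U} (o + g_p + g_p')(a) = Σ_{A ⊆ U} Σ_{A₁ ⊆ A} term`. -/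
theorem prod_pt2_eq (p p' : Fin K) :
    ∏ a ∈ U, pt2 tx p p' a = ∑ A ∈ U.powerset, ∑ A₁ ∈ A.powerset, term tx U p p' A A₁ := by
  have hre : ∀ a, pt2 tx p p' a = (tx (some p) a + tx (some p') a) + tx none a := by
    intro a; simp only [pt2]; ring
  simp_rw [hre]
  rw [Finset.prod_add]
  refine Finset.sum_congr rfl fun A _ => ?_
  rw [Finset.prod_add, Finset.sum_mul]
  rfl

/-- `∏_{a∈U} (o + g_p)(a) = Σ_{A ⊆ U} term A A`. -/
theorem prod_pt1_left_eq (p p' : Fin K) :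
    ∏ a ∈ U, pt1 tx p a = ∑ A ∈ U.powerset, term tx U p p' A A := by
  have hre : ∀ a, pt1 tx p a = tx (some p) a + tx none a := by intro a; simp only [pt1]; ring
  simp_rw [hre]
  rw [Finset.prod_add]
  refine Finset.sum_congr rfl fun A _ => ?_
  simp [term]

/-- `∏_{a∈U} (o + g_{p'})(a) = Σ_{A ⊆ U} term A ∅`. -/
theorem prod_pt1_right_eq (p p' : Fin K) :
    ∏ a ∈ U, pt1 tx p' a = ∑ A ∈ U.powerset, term tx U p p' A ∅ := by
  have hre : ∀ a, pt1 tx p' a = tx (some p') a + tx none a := by intro a; simp only [pt1]; ring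
  simp_rw [hre]
  rw [Finset.prod_add]
  refine Finset.sum_congr rfl fun A _ => ?_
  simp [term]

/-- `∏_{a∈U} o(a) = term ∅ ∅`. -/
theorem prod_pt0_eq (p p' : Fin K) : ∏ a ∈ U, pt0 tx a = term tx U p p' ∅ ∅ := by
  simp [term, pt0]

/-- The second difference, expanded. -/
theorem secondDiff_expand (p p' : Fin K) :
    secondDiff tx U p p' = (∑ A ∈ U.powerset,
      ((∑ A₁ ∈ A.powerset, term tx U p p' A A₁) - term tx U p p' A A - term tx U p p' A ∅)) + term tx U p p' ∅ ∅ := by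
  rw [secondDiff, prod_pt2_eq, prod_pt1_left_eq tx U p p', prod_pt1_right_eq tx U p p', prod_pt0_eq tx U p p',
    Finset.sum_sub_distrib, Finset.sum_sub_distrib]

end expansion

/-! ## 2. The level-q law -/

section law

variable (tx : Option (Fin K) → Fin h → ℂ) (S : Finset (Fin K)) (T : Finset (Fin h)) (β : Fin K → Fin K → ℂ) (q : ℕ)
  (hsym : ∀ p ∈ S, ∀ p' ∈ S, β p p' = β p' p)
  (hΛ : ∀ A : Finset (Fin h), A ⊆ T → A.Nonempty → A.card ≤ q →
    ∀ p' ∈ S, ∑ p ∈ S, β p p' * ∏ a ∈ A, tx (some p) a = 0)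
include hsym hΛ

/-- The weighted term sum `T(A, A₁) = Σ_{p,p'} β p p' · term` vanishes when both `A₁` and `A ∖ A₁` are nonempty and `|A| ≤ 2q+1`. -/
theorem sum_term_eq_zero (U : Finset (Fin h)) {A A₁ : Finset (Fin h)} (hAT : A ⊆ T) (hA : A.card ≤ 2 * q + 1)
    (hA₁A : A₁ ⊆ A) (h₁ : A₁.Nonempty) (h₂ : (A \ A₁).Nonempty) :
    ∑ p ∈ S, ∑ p' ∈ S, β p p' * term tx U p p' A A₁ = 0 := by
  have hcard : A₁.card + (A \ A₁).card = A.card := by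
    rw [Finset.card_sdiff_of_subset hA₁A]; exact Nat.add_sub_of_le (Finset.card_le_card hA₁A)
  by_cases hsmall : A₁.card ≤ q
  · -- the left factor is a Veronese syzygy
    rw [Finset.sum_comm]
    refine Finset.sum_eq_zero fun p' hp' => ?_
    have hz := hΛ A₁ (hA₁A.trans hAT) h₁ hsmall p' hp'
    calc ∑ p ∈ S, β p p' * term tx U p p' A A₁
        = (∑ p ∈ S, β p p' * ∏ a ∈ A₁, tx (some p) a) *
            ((∏ a ∈ A \ A₁, tx (some p') a) * ∏ a ∈ U \ A, tx none a) := by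
          rw [Finset.sum_mul]; exact Finset.sum_congr rfl fun p _ => by unfold term; ring
      _ = 0 := by rw [hz, zero_mul]
  · -- the right factor is a Veronese syzygy (use symmetry)
    have hsmall' : (A \ A₁).card ≤ q := by omega
    refine Finset.sum_eq_zero fun p hp => ?_
    have hz := hΛ (A \ A₁) (Finset.sdiff_subset.trans hAT) h₂ hsmall' p hp
    calc ∑ p' ∈ S, β p p' * term tx U p p' A A₁
        = ((∏ a ∈ A₁, tx (some p) a) * ∏ a ∈ U \ A, tx none a) *
            ∑ p' ∈ S, β p' p * ∏ a ∈ A \ A₁, tx (some p') a := by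
          rw [Finset.mul_sum]
          exact Finset.sum_congr rfl fun p' hp' => by unfold term; rw [hsym p hp p' hp']; ring
      _ = 0 := by rw [hz, mul_zero]

/-- **THE SYM²-SYZYGY LAW AT LEVEL q.** For a symmetric level-q syzygy matrix and a row `U ⊆ T` with `|U| ≤ 2q+1`,
`Σ_{p,p'∈S} β p p' · secondDiff U p p' = 0`. -/
theorem sum_secondDiff_eq_zero_veronese (U : Finset (Fin h)) (hUT : U ⊆ T) (hU : U.card ≤ 2 * q + 1) :
    ∑ p ∈ S, ∑ p' ∈ S, β p p' * secondDiff tx U p p' = 0 := by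
  classical
  -- abbreviation for the weighted term sums
  set Tm : Finset (Fin h) → Finset (Fin h) → ℂ := fun A A₁ => ∑ p ∈ S, ∑ p' ∈ S, β p p' * term tx U p p' A A₁ with hTm
  -- push the weights through the expansion
  have hpush : ∑ p ∈ S, ∑ p' ∈ S, β p p' * secondDiff tx U p p' =
      (∑ A ∈ U.powerset, ((∑ A₁ ∈ A.powerset, Tm A A₁) - Tm A A - Tm A ∅)) + Tm ∅ ∅ := by
    simp_rw [secondDiff_expand, mul_add, Finset.sum_add_distrib, Finset.mul_sum, mul_sub, Finset.sum_sub_distrib,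
      Finset.mul_sum]
    have e1 : ∑ p ∈ S, ∑ p' ∈ S, ∑ A ∈ U.powerset, ∑ A₁ ∈ A.powerset, β p p' * term tx U p p' A A₁ =
        ∑ A ∈ U.powerset, ∑ A₁ ∈ A.powerset, Tm A A₁ := by
      calc ∑ p ∈ S, ∑ p' ∈ S, ∑ A ∈ U.powerset, ∑ A₁ ∈ A.powerset, β p p' * term tx U p p' A A₁
          = ∑ p ∈ S, ∑ A ∈ U.powerset, ∑ p' ∈ S, ∑ A₁ ∈ A.powerset, β p p' * term tx U p p' A A₁ :=
            Finset.sum_congr rfl fun p _ => Finset.sum_comm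
        _ = ∑ A ∈ U.powerset, ∑ p ∈ S, ∑ p' ∈ S, ∑ A₁ ∈ A.powerset, β p p' * term tx U p p' A A₁ := Finset.sum_comm
        _ = ∑ A ∈ U.powerset, ∑ p ∈ S, ∑ A₁ ∈ A.powerset, ∑ p' ∈ S, β p p' * term tx U p p' A A₁ :=
            Finset.sum_congr rfl fun A _ => Finset.sum_congr rfl fun p _ => Finset.sum_comm
        _ = ∑ A ∈ U.powerset, ∑ A₁ ∈ A.powerset, ∑ p ∈ S, ∑ p' ∈ S, β p p' * term tx U p p' A A₁ :=
            Finset.sum_congr rfl fun A _ => Finset.sum_comm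
        _ = ∑ A ∈ U.powerset, ∑ A₁ ∈ A.powerset, Tm A A₁ := rfl
    have e2 : ∀ f : Finset (Fin h) → Fin K → Fin K → ℂ,
        ∑ p ∈ S, ∑ p' ∈ S, ∑ A ∈ U.powerset, β p p' * f A p p' = ∑ A ∈ U.powerset, ∑ p ∈ S, ∑ p' ∈ S, β p p' * f A p p' := by
      intro f
      calc ∑ p ∈ S, ∑ p' ∈ S, ∑ A ∈ U.powerset, β p p' * f A p p'
          = ∑ p ∈ S, ∑ A ∈ U.powerset, ∑ p' ∈ S, β p p' * f A p p' := Finset.sum_congr rfl fun p _ => Finset.sum_comm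
        _ = ∑ A ∈ U.powerset, ∑ p ∈ S, ∑ p' ∈ S, β p p' * f A p p' := Finset.sum_comm
    rw [e1, e2 (fun A p p' => term tx U p p' A A), e2 (fun A p p' => term tx U p p' A ∅)]
  rw [hpush]
  -- each A contributes 0, except A = ∅ which contributes −Tm ∅ ∅
  have hA : ∀ A ∈ U.powerset, (∑ A₁ ∈ A.powerset, Tm A A₁) - Tm A A - Tm A ∅ = if A = ∅ then -Tm ∅ ∅ else 0 := by
    intro A hAU
    have hAT : A ⊆ T := (Finset.mem_powerset.mp hAU).trans hUT
    have hAc : A.card ≤ 2 * q + 1 := (Finset.card_le_card (Finset.mem_powerset.mp hAU)).trans hU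
    by_cases hA0 : A = ∅
    · subst hA0; simp
    · rw [if_neg hA0]
      have hsum : ∑ A₁ ∈ A.powerset, Tm A A₁ = Tm A ∅ + Tm A A := by
        refine Finset.sum_eq_add ∅ A (fun heq => hA0 heq.symm) ?_ ?_ ?_
        · intro A₁ hA₁ hne
          have hsub : A₁ ⊆ A := Finset.mem_powerset.mp hA₁
          have h1 : A₁.Nonempty := Finset.nonempty_iff_ne_empty.mpr hne.1
          have h2 : (A \ A₁).Nonempty := by
            rw [Finset.sdiff_nonempty]; intro hAA₁; exact hne.2 (Finset.Subset.antisymm hsub hAA₁)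
          exact sum_term_eq_zero tx S T β q hsym hΛ U hAT hAc hsub h1 h2
        · intro habs; exact absurd (Finset.empty_mem_powerset A) habs
        · intro habs; exact absurd (Finset.mem_powerset.mpr (subset_refl A)) habs
      rw [hsum]; ring
  rw [Finset.sum_congr rfl hA, Finset.sum_ite_eq' U.powerset ∅ (fun _ => -Tm ∅ ∅), if_pos (Finset.empty_mem_powerset U)]
  ring

end law

/-! ## 3. The vanishing determinant -/

section det

variable {n : Type*} [Fintype n]
variable (tx : Option (Fin K) → Fin h → ℂ) (u : n → Finset (Fin h)) (e : n → Finset (Fin K)) (he : Function.Injective e)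
  (S : Finset (Fin K)) (β : Fin K → Fin K → ℂ)
  (h0 : ∃ k, e k = ∅) (h1 : ∀ p ∈ S, ∃ k, e k = {p})
  (h2 : ∀ p ∈ S, ∀ p' ∈ S, p ≠ p' → ∃ k, e k = insert p {p'})

include he h0 h1 h2 in
/-- The matrix kills `relVec` as soon as the weighted second differences vanish on every row. -/
theorem mulVec_relVec_of_vanishing (hdiag : ∀ p ∈ S, β p p = 0)
    (hvan : ∀ i, ∑ p ∈ S, ∑ p' ∈ S, β p p' * secondDiff tx (u i) p p' = 0) :
    (Matrix.of fun i k : n => ∏ a ∈ u i, (tx none a + ∑ q ∈ e k, tx (some q) a)) *ᵥ relVec e S β = 0 := by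
  classical
  funext i
  rw [Pi.zero_apply, Matrix.mulVec, dotProduct]
  simp only [matrix_apply]
  have hstep : ∑ k, colVal tx (u i) (e k) * relVec e S β k =
      ∑ p ∈ S, ∑ p' ∈ S, β p p' *
        (colVal tx (u i) (insert p {p'}) - colVal tx (u i) {p} - colVal tx (u i) {p'} + colVal tx (u i) ∅) := by
    unfold relVec
    simp_rw [Finset.mul_sum]
    rw [Finset.sum_comm]
    refine Finset.sum_congr rfl fun p hp => ?_
    rw [Finset.sum_comm]
    refine Finset.sum_congr rfl fun p' hp' => ?_
    have hpair : ∃ k, e k = insert p {p'} := by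
      by_cases hpp : p = p'
      · subst hpp; simpa using h1 p hp
      · exact h2 p hp p' hp' hpp
    have hA := sum_row_ite tx u e he i hpair
    have hB := sum_row_ite tx u e he i (h1 p hp)
    have hC := sum_row_ite tx u e he i (h1 p' hp')
    have hD := sum_row_ite tx u e he i h0
    have hsplit : ∀ k, colVal tx (u i) (e k) * (β p p' *
        ((if e k = insert p {p'} then 1 else 0) - (if e k = {p} then 1 else 0) - (if e k = {p'} then 1 else 0) +
          (if e k = ∅ then 1 else 0))) =
        β p p' * (colVal tx (u i) (e k) * (if e k = insert p {p'} then (1:ℂ) else 0)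
          - colVal tx (u i) (e k) * (if e k = {p} then (1:ℂ) else 0)
          - colVal tx (u i) (e k) * (if e k = {p'} then (1:ℂ) else 0)
          + colVal tx (u i) (e k) * (if e k = ∅ then (1:ℂ) else 0)) := by
      intro k; ring
    simp_rw [hsplit]
    rw [← Finset.mul_sum, Finset.sum_add_distrib, Finset.sum_sub_distrib, Finset.sum_sub_distrib, hA, hB, hC, hD]
  rw [hstep]
  have hbr : ∀ p ∈ S, ∀ p' ∈ S, β p p' *
      (colVal tx (u i) (insert p {p'}) - colVal tx (u i) {p} - colVal tx (u i) {p'} + colVal tx (u i) ∅) =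
      β p p' * secondDiff tx (u i) p p' := by
    intro p hp p' hp'
    by_cases hpp : p = p'
    · subst hpp; rw [hdiag p hp, zero_mul, zero_mul]
    · rw [secondDiff, colVal_pair tx (u i) hpp, colVal_single, colVal_single, colVal_empty]
  rw [Finset.sum_congr rfl fun p hp => Finset.sum_congr rfl fun p' hp' => hbr p hp p' hp']
  exact hvan i

include he h0 h1 h2 in
/-- **THE LEVEL-q LAW AS A VANISHING DETERMINANT.** Rows inside `B_{2q+1}(T)`; columns containing the complete pair ball on `S` with its origin;
a nonzero symmetric level-q syzygy matrix with zero diagonal ⇒ singular for this table. -/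
theorem det_eq_zero_of_veronese [DecidableEq n] (T : Finset (Fin h)) (q : ℕ)
    (hsym : ∀ p ∈ S, ∀ p' ∈ S, β p p' = β p' p) (hdiag : ∀ p ∈ S, β p p = 0)
    (hΛ : ∀ A : Finset (Fin h), A ⊆ T → A.Nonempty → A.card ≤ q → ∀ p' ∈ S, ∑ p ∈ S, β p p' * ∏ a ∈ A, tx (some p) a = 0)
    (hne : ∃ p ∈ S, ∃ p' ∈ S, β p p' ≠ 0) (hrows : ∀ i, u i ⊆ T ∧ (u i).card ≤ 2 * q + 1) :
    (Matrix.of fun i k : n => ∏ a ∈ u i, (tx none a + ∑ q ∈ e k, tx (some q) a)).det = 0 := by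
  classical
  exact Matrix.exists_mulVec_eq_zero_iff.mp
    ⟨relVec e S β, relVec_ne_zero e S β h2 hsym hdiag hne,
      mulVec_relVec_of_vanishing tx u e he S β h0 h1 h2 hdiag
        (fun i => sum_secondDiff_eq_zero_veronese tx S T β q hsym hΛ (u i) (hrows i).1 (hrows i).2)⟩

end det

/-! ## 4. Existence of a level-q syzygy matrix, for every table -/

section count

variable (tx : Option (Fin K) → Fin h → ℂ) (S : Finset (Fin K)) (T : Finset (Fin h)) (q : ℕ)

/-- The index set of the degree-≤q Veronese: nonempty subsets of `T` of size `≤ q`. -/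
def verIdx : Finset (Finset (Fin h)) := T.powerset.filter fun A => A.Nonempty ∧ A.card ≤ q

/-- The Veronese matrix on `verIdx × S`: entry `(A, p) = ∏_{a∈A} g_p(a)`. -/
def verMat : Matrix ↥(verIdx T q) ↥S ℂ := Matrix.of fun A p => ∏ a ∈ (A : Finset (Fin h)), tx (some (p : Fin K)) a

/-- The level-q syzygy space has dimension at least `|S| − |verIdx|`. -/
theorem le_finrank_ker_ver : S.card - (verIdx T q).card ≤ finrank ℂ (LinearMap.ker (verMat tx S T q).mulVecLin) := by
  classical
  have h₁ := (verMat tx S T q).mulVecLin.finrank_range_add_finrank_ker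
  have h₂ : finrank ℂ (LinearMap.range (verMat tx S T q).mulVecLin) ≤ finrank ℂ (↥(verIdx T q) → ℂ) := Submodule.finrank_le _
  rw [Module.finrank_fintype_fun_eq_card, Fintype.card_coe] at h₁ h₂
  omega

/-- **EXISTENCE OF A NONZERO SYMMETRIC LEVEL-q SYZYGY MATRIX WITH ZERO DIAGONAL, FOR EVERY TABLE**, once `C(|S|−M+1, 2) > |S|`,
`M = #{A ⊆ T : 1 ≤ |A| ≤ q}`. -/
theorem exists_veroneseSyzygyMatrix (hcount : S.card < Nat.choose (S.card - (verIdx T q).card + 1) 2) :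
    ∃ β : Fin K → Fin K → ℂ, (∀ p ∈ S, ∀ p' ∈ S, β p p' = β p' p) ∧ (∀ p ∈ S, β p p = 0) ∧
      (∀ A : Finset (Fin h), A ⊆ T → A.Nonempty → A.card ≤ q → ∀ p' ∈ S, ∑ p ∈ S, β p p' * ∏ a ∈ A, tx (some p) a = 0) ∧
      ∃ p ∈ S, ∃ p' ∈ S, β p p' ≠ 0 := by
  classical
  set Λ := LinearMap.ker (verMat tx S T q).mulVecLin with hΛ
  set d := finrank ℂ Λ with hd
  have hdle : S.card - (verIdx T q).card ≤ d := le_finrank_ker_ver tx S T q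
  let bΛ : Basis (Fin d) ℂ Λ := Module.finBasis ℂ Λ
  let v : Fin d → (↥S → ℂ) := fun i => (bΛ i : ↥S → ℂ)
  have hv : LinearIndependent ℂ v := bΛ.linearIndependent.map' Λ.subtype Λ.ker_subtype
  have hvΛ : ∀ i, ∀ A : ↥(verIdx T q), ∑ p : ↥S, (∏ a ∈ (A : Finset (Fin h)), tx (some (p : Fin K)) a) * v i p = 0 := by
    intro i A
    have hmem : (v i) ∈ Λ := (bΛ i).2
    rw [hΛ, LinearMap.mem_ker] at hmem
    have := congrFun hmem A
    simpa [Matrix.mulVecLin_apply, Matrix.mulVec, dotProduct, verMat] using this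
  let Δ : (Sym2 (Fin d) → ℂ) →ₗ[ℂ] (↥S → ℂ) :=
    { toFun := fun c p => ∑ i, ∑ j, c s(i, j) * v i p * v j p
      map_add' := by
        intro c c'; funext p
        simp only [Pi.add_apply, add_mul, Finset.sum_add_distrib]
      map_smul' := by
        intro r c; funext p
        simp only [Pi.smul_apply, smul_eq_mul, RingHom.id_apply, Finset.mul_sum]
        refine Finset.sum_congr rfl fun i _ => Finset.sum_congr rfl fun j _ => by ring }
  have hlt : finrank ℂ (↥S → ℂ) < finrank ℂ (Sym2 (Fin d) → ℂ) := by
    rw [Module.finrank_fintype_fun_eq_card, Module.finrank_fintype_fun_eq_card, Fintype.card_coe, Sym2.card, Fintype.card_fin]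
    exact lt_of_lt_of_le hcount (Nat.choose_le_choose 2 (by omega))
  obtain ⟨c, hcker, hc0⟩ := Submodule.exists_mem_ne_zero_of_ne_bot (LinearMap.ker_ne_bot_of_finrank_lt (f := Δ) hlt)
  rw [LinearMap.mem_ker] at hcker
  refine ⟨extendβ S (symOf S v c), ?_, ?_, ?_, ?_⟩
  · intro p hp p' hp'
    simp only [extendβ, dif_pos hp, dif_pos hp']
    exact symOf_symm S v c _ _
  · intro p hp
    have := congrFun hcker ⟨p, hp⟩
    simp only [Δ, LinearMap.coe_mk, AddHom.coe_mk, Pi.zero_apply] at this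
    simp only [extendβ, dif_pos hp, symOf]
    exact this
  · intro A hAT hA hAq p' hp'
    have hAidx : A ∈ verIdx T q := by
      simp only [verIdx, Finset.mem_filter, Finset.mem_powerset]; exact ⟨hAT, hA, hAq⟩
    rw [← Finset.sum_attach S]
    have hrw : ∀ p : ↥S, extendβ S (symOf S v c) p p' * ∏ a ∈ A, tx (some (p : Fin K)) a =
        ∑ i, (∑ j, c s(i, j) * v j ⟨p', hp'⟩) * ((∏ a ∈ A, tx (some (p : Fin K)) a) * v i p) := by
      intro p
      simp only [extendβ, dif_pos p.2, dif_pos hp', symOf]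
      rw [Finset.sum_mul]
      refine Finset.sum_congr rfl fun i _ => ?_
      rw [Finset.sum_mul, Finset.sum_mul]
      exact Finset.sum_congr rfl fun j _ => by ring
    have hattach : ∑ p ∈ S.attach, extendβ S (symOf S v c) p p' * ∏ a ∈ A, tx (some (p : Fin K)) a =
        ∑ p : ↥S, extendβ S (symOf S v c) p p' * ∏ a ∈ A, tx (some (p : Fin K)) a := rfl
    rw [hattach]
    simp_rw [hrw]
    rw [Finset.sum_comm]
    refine Finset.sum_eq_zero fun i _ => ?_
    rw [← Finset.mul_sum, hvΛ i ⟨A, hAidx⟩, mul_zero]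
  · by_contra hnone
    push Not at hnone
    apply hc0
    apply symOf_eq_zero S v hv c
    funext p p'
    have := hnone p p.2 p' p'.2
    simpa [extendβ, dif_pos p.2, dif_pos p'.2] using this

/-- **THE LEVEL-q SYM²-SYZYGY LAW IN CLOSED FORM: for EVERY table, a block-additive matrix whose column family contains a complete pair ball on
`S` with its origin and whose rows lie in `B_{2q+1}(T)` is singular once `C(|S| − #{A ⊆ T : 1 ≤ |A| ≤ q} + 1, 2) > |S|`.** -/
theorem det_eq_zero_of_veronese_count {n : Type*} [Fintype n] [DecidableEq n] (u : n → Finset (Fin h)) (e : n → Finset (Fin K))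
    (he : Function.Injective e) (h0 : ∃ k, e k = ∅) (h1 : ∀ p ∈ S, ∃ k, e k = {p})
    (h2 : ∀ p ∈ S, ∀ p' ∈ S, p ≠ p' → ∃ k, e k = insert p {p'})
    (hrows : ∀ i, u i ⊆ T ∧ (u i).card ≤ 2 * q + 1) (hcount : S.card < Nat.choose (S.card - (verIdx T q).card + 1) 2) :
    (Matrix.of fun i k : n => ∏ a ∈ u i, (tx none a + ∑ q ∈ e k, tx (some q) a)).det = 0 := by
  obtain ⟨β, hsym, hdiag, hΛ, hne⟩ := exists_veroneseSyzygyMatrix tx S T q hcount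
  exact det_eq_zero_of_veronese tx u e he S β h0 h1 h2 T q hsym hdiag hΛ hne hrows

end count

end SymSyzygy

end

end Summit.ValiantsHypothesis.ValiantsHypothesis.Theorems.BarrierLever.HiddenStates
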